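import Summits.QuantumFields.YangMills.Theorems.LangevinControlUVOSLegsFromFemtoAndGapDefsR3
import HarnessLib

/-!
# Stub `stub_growth` of line `dlr-collar-transfer` (crux `OSLegsFromFemtoAndGap`, stmt-QuantumFields-9367, reshape r3)

`theorem stub_growth : Statement.stub_growth` — the joint soft legs of toolkit XV (`softLegs_joint`,
`…StubAssemblySoftLegsJoint.lean`) along a scheme meeting, in addition, a coupling threshold `b₀ ≤ β_k` and an
ARBITRARY growth demand `g (β_k) k ≤ L_k` on the torus sides, i.e. a `SoftBundle G r a sch S₁ Tq K b₀ g` for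
every `b₀ : ℝ` and every `g : ℝ → ℕ → ℕ`.

Proof (`softLegs_joint_growth`, in the toolkit namespace): the proof of `softLegs_joint` re-run with two
changes — the base coupling is `B := max (…) (max B₁ (max 0 b₀))` (so `b₀ ≤ β_k`), and the torus sides are
`L_k := max (old L_k) (max_{i ≤ k} g (β_k) i)` (the running maximum of the demand at coupling `β_k`).  The
compactness subsequence `φ` (`exists_subseq_clm_limit`) is strictly monotone, so `j ≤ φ j` and
`L_{φ j} ≥ max_{i ≤ φ j} g (β_{φ j}) i ≥ g (β_{φ j}) j`, which is the demand along the scheme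
`sch.β j = β_{φ j}`, `sch.L j = L_{φ j}`.  Everything else is byte-identical with toolkit XV; `stub_growth` is the
uncurried form.
-/

set_option autoImplicit false

noncomputable section

open scoped SchwartzMap BigOperators
open MeasureTheory Filter Topology
open Literature.MathematicalPhysics.QuantumFieldTheory Literature.MathematicalPhysics.QuantumLattice
open Literature.MathematicalPhysics.AQFT
open Literature.Probability.LatticeModels (box Site)
open Summit.QuantumFields.YangMills.Cruxes.OSLegsFromFemtoAndGap.DlrCollarTransfer
  (MomentBounds6 LowerBounds GapInUnits SoftBundle)
open Summit.QuantumFields.YangMills.Theorems.OSLegsFromFemtoAndGap.Negative (hasLatticeMassGap_of_gapInUnits)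

namespace Summit.QuantumFields.YangMills.Theorems.OSLegsFromFemtoAndGap

local notation "E4" => EuclideanSpace ℝ (Fin 4)

variable {G : Type} [Group G] [TopologicalSpace G] [IsTopologicalGroup G] [CompactSpace G]
  [MeasurableSpace G] [BorelSpace G]

/-- **Joint soft legs meeting a coupling threshold and a growth demand.**  From `(∀ β, 0 < a β)`, `a → 0`,
`MomentBounds6`, `LowerBounds`, `GapInUnits`, every threshold `b₀` and every demand `g : ℝ → ℕ → ℕ` one gets a
scheme `sch` in units `a`, a one-field family `S₁`, plane-string limits `Tq` and an a-uniform constant `K` with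
the whole export list of `softLegs_joint` and, in addition, `b₀ ≤ sch.β k` and `g (sch.β k) k ≤ sch.L k` for
every `k` (toolkit XV re-run with `β_k ≥ b₀` and `L_k ≥ max_{i ≤ k} g (β_k) i`). -/
theorem softLegs_joint_growth (r : LatticeRep G) {a : ℝ → ℝ} (hapos : ∀ β, 0 < a β)
    (hlim : Tendsto a atTop (𝓝 0)) (hMB : MomentBounds6 G r a) (hLB : LowerBounds G r a)
    (hgap : GapInUnits G r a) (b₀ : ℝ) (g : ℝ → ℕ → ℕ) :
    ∃ (sch : SpeciesScheme (YMSpecies G)) (S₁ : SchwingerFamily E4)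
      (Tq : (n : ℕ) → (Fin n → Fin 4 × Fin 4) → (𝓢((Fin n → E4), ℂ) →L[ℂ] ℂ)) (K : ℝ),
      SoftBundle G r a sch S₁ Tq K b₀ g := by
  classical
  unfold SoftBundle
  /- 1. CONSTANTS: the a-uniform bound for plane strings (XIV), the gap data, the lower-bound data -/
  obtain ⟨β₄, ℓ₄, K, hℓ, hK, Hbd⟩ := exists_planeString_bounds r hMB
  obtain ⟨c₁, β₂, S₁g, hc₁, Hgap⟩ := hgap
  obtain ⟨⟨v, ε₂, β₅, Λ₅, hv, hε₂, HQ2⟩, ⟨f₃, g₃, h₃, ε₃, β₆, Λ₆, hfg, hgh, hfh, hε₃, HQ3⟩⟩ := hLB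
  -- `a β ≤ min (1/24) ℓ₄` for `β ≥ B₁`
  obtain ⟨B₁, hB₁⟩ : ∃ B₁ : ℝ, ∀ β, B₁ ≤ β → a β < min (1 / 24) ℓ₄ :=
    Filter.eventually_atTop.1 (hlim.eventually (gt_mem_nhds (by positivity)))
  /- 2. THE SEQUENCES: couplings above every threshold (including `b₀`), spacings, tori (including the
    running maximum of the demand `g`) -/
  obtain ⟨B, hBdef⟩ : ∃ B : ℝ, B = max (max (max β₄ β₂) (max β₅ β₆)) (max B₁ (max 0 b₀)) := ⟨_, rfl⟩
  obtain ⟨βs, hβs⟩ : ∃ βs : ℕ → ℝ, βs = fun k : ℕ => B + (k : ℝ) := ⟨_, rfl⟩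
  have hβsB : ∀ k, B ≤ βs k := fun k => by rw [hβs]; simp
  have hβs4 : ∀ k, β₄ ≤ βs k := fun k => le_trans (by rw [hBdef]; simp) (hβsB k)
  have hβs2 : ∀ k, β₂ ≤ βs k := fun k => le_trans (by rw [hBdef]; simp) (hβsB k)
  have hβs5 : ∀ k, β₅ ≤ βs k := fun k => le_trans (by rw [hBdef]; simp) (hβsB k)
  have hβs6 : ∀ k, β₆ ≤ βs k := fun k => le_trans (by rw [hBdef]; simp) (hβsB k)
  have hβs1 : ∀ k, B₁ ≤ βs k := fun k => le_trans (by rw [hBdef]; simp) (hβsB k)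
  have hβs0 : ∀ k, 0 ≤ βs k := fun k => le_trans (by rw [hBdef]; simp) (hβsB k)
  have hβsb : ∀ k, b₀ ≤ βs k := fun k => le_trans (by rw [hBdef]; simp) (hβsB k)
  have hβs_top : Tendsto βs atTop atTop := by rw [hβs]; exact tendsto_const_add_natCast B
  have ha_pos : ∀ k, 0 < a (βs k) := fun k => hapos _
  have ha_24 : ∀ k, a (βs k) ≤ 1 / 24 := fun k => (hB₁ _ (hβs1 k)).le.trans (min_le_left _ _)
  have ha_1 : ∀ k, a (βs k) ≤ 1 := fun k => (ha_24 k).trans (by norm_num)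
  have ha_ℓ : ∀ k, a (βs k) ≤ ℓ₄ := fun k => (hB₁ _ (hβs1 k)).le.trans (min_le_right _ _)
  have ha_top : Tendsto (fun k => a (βs k)) atTop (𝓝 0) := hlim.comp hβs_top
  obtain ⟨Ls, hLs⟩ : ∃ Ls : ℕ → ℕ, Ls = fun k =>
      max (max (max 14 (S₁g (βs k))) (max ⌈(a (βs k))⁻¹ * (a (βs k))⁻¹⌉₊ ⌈max Λ₅ Λ₆ / a (βs k)⌉₊))
        ((Finset.range (k + 1)).sup (g (βs k))) := ⟨_, rfl⟩
  have hL14 : ∀ k, 14 ≤ Ls k := fun k => by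
    rw [hLs]; exact le_trans (le_trans (le_max_left _ _) (le_max_left _ _)) (le_max_left _ _)
  have hLS : ∀ k, S₁g (βs k) ≤ Ls k := fun k => by
    rw [hLs]; exact le_trans (le_trans (le_max_right _ _) (le_max_left _ _)) (le_max_left _ _)
  have hLa : ∀ k, (a (βs k))⁻¹ * (a (βs k))⁻¹ ≤ Ls k := fun k => by
    have h1 : ((⌈(a (βs k))⁻¹ * (a (βs k))⁻¹⌉₊ : ℕ) : ℝ) ≤ Ls k := by
      rw [hLs]; exact_mod_cast le_trans (le_trans (le_max_left _ _) (le_max_right _ _)) (le_max_left _ _)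
    exact (Nat.le_ceil _).trans h1
  have hLΛ : ∀ k, max Λ₅ Λ₆ ≤ a (βs k) * Ls k := fun k => by
    have h1 : ((⌈max Λ₅ Λ₆ / a (βs k)⌉₊ : ℕ) : ℝ) ≤ Ls k := by
      rw [hLs]; exact_mod_cast le_trans (le_trans (le_max_right _ _) (le_max_right _ _)) (le_max_left _ _)
    have h2 : max Λ₅ Λ₆ / a (βs k) ≤ Ls k := (Nat.le_ceil _).trans h1
    rw [div_le_iff₀ (ha_pos k)] at h2
    linarith [mul_comm (Ls k : ℝ) (a (βs k))]
  have hLg : ∀ k, (Finset.range (k + 1)).sup (g (βs k)) ≤ Ls k := fun k => by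
    rw [hLs]; exact le_max_right _ _
  have haL_top : Tendsto (fun k => a (βs k) * Ls k) atTop atTop := by
    -- `a L ≥ a · a⁻² = a⁻¹ → ∞`
    have h1 : Tendsto (fun k => (a (βs k))⁻¹) atTop atTop :=
      tendsto_inv_nhdsGT_zero.comp (tendsto_nhdsWithin_iff.2 ⟨ha_top, Eventually.of_forall fun k => ha_pos k⟩)
    refine tendsto_atTop_mono (fun k => ?_) h1
    have := mul_le_mul_of_nonneg_left (hLa k) (ha_pos k).le
    rwa [← mul_assoc, mul_inv_cancel₀ (ha_pos k).ne', one_mul] at this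
  /- 3. THE JOINT SUBSEQUENCE AND THE LIMITS of all plane-string distributions on `⁰𝒮ₙ`, `n ≥ 2` -/
  -- shorthand for the string observables / weights / distributions at step `k`
  have Hstr : ∀ (k n : ℕ), 2 ≤ n → ∀ q : Fin n → Fin 4 × Fin 4, (∀ i, (q i).1 < (q i).2) →
      ∀ F : 𝓢((Fin n → E4), ℂ), IsOffDiagonal F →
      ∀ y : (Fin n → Site 4) → (Fin n → E4), (∀ x l, ‖y x l - a (βs k) • siteToE (x l)‖ ≤ 6 * a (βs k)) →
        ‖∑ x ∈ Fintype.piFinset (fun _ : Fin n => box 4 (Ls k)),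
            ((torusMomentStr r.ρ (βs k) (Ls k) (fun i U => plaquetteObs r.ρ 0 (q i).1 (q i).2 U)
              (fun i => wilsonTorusMean r.ρ (βs k) (Ls k) (fun U => plaquetteObs r.ρ 0 (q i).1 (q i).2 U)) x : ℝ) : ℂ) *
            F (y x)‖ ≤
          K ^ n * (SchwartzMap.seminorm ℂ 0 (4 * n) F + SchwartzMap.seminorm ℂ (6 * n) (4 * n) F +
            SchwartzMap.seminorm ℂ 0 0 F + SchwartzMap.seminorm ℂ (6 * n) 0 F +
            SchwartzMap.seminorm ℂ (10 * n) 0 F) :=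
    fun k n hn q hq F hF y hy =>
      (Hbd (βs k) (hβs4 k) (ha_pos k) (ha_24 k) (ha_ℓ k) (Ls k) (hL14 k) (hLa k) n hn q hq F hF).1 y hy
  have Hdef : ∀ (k n : ℕ), 2 ≤ n → ∀ q : Fin n → Fin 4 × Fin 4, (∀ i, (q i).1 < (q i).2) →
      ∀ F : 𝓢((Fin n → E4), ℂ), IsOffDiagonal F → ∀ c : Fin n → E4, (∀ l, ‖c l‖ ≤ a (βs k)) →
        ‖∑ x ∈ Fintype.piFinset (fun _ : Fin n => box 4 (Ls k)),
            ((torusMomentStr r.ρ (βs k) (Ls k) (fun i U => plaquetteObs r.ρ 0 (q i).1 (q i).2 U)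
              (fun i => wilsonTorusMean r.ρ (βs k) (Ls k) (fun U => plaquetteObs r.ρ 0 (q i).1 (q i).2 U)) x : ℝ) : ℂ) *
            (F ((fun l => a (βs k) • siteToE (x l)) + c) - F (fun l => a (βs k) • siteToE (x l)))‖ ≤
          2 * ‖c‖ * K ^ n * (SchwartzMap.seminorm ℂ 0 (4 * n + 1) F + SchwartzMap.seminorm ℂ (6 * n) (4 * n + 1) F +
            SchwartzMap.seminorm ℂ 0 1 F + SchwartzMap.seminorm ℂ (6 * n) 1 F + SchwartzMap.seminorm ℂ (10 * n) 1 F) :=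
    fun k n hn q hq F hF c hc =>
      (Hbd (βs k) (hβs4 k) (ha_pos k) (ha_24 k) (ha_ℓ k) (Ls k) (hL14 k) (hLa k) n hn q hq F hF).2 c hc
  have hlatStr : ∀ (k n : ℕ), 2 ≤ n → ∀ q : Fin n → Fin 4 × Fin 4, (∀ i, (q i).1 < (q i).2) →
      ∀ F : 𝓢((Fin n → E4), ℂ), IsOffDiagonal F →
        ‖latticeDistStr r.ρ (βs k) (Ls k) (a (βs k)) (fun i U => plaquetteObs r.ρ 0 (q i).1 (q i).2 U)
          (fun i => wilsonTorusMean r.ρ (βs k) (Ls k) (fun U => plaquetteObs r.ρ 0 (q i).1 (q i).2 U)) F‖ ≤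
          5 * K ^ n * schwartzNorm (10 * n) F := by
    intro k n hn q hq F hF
    rw [latticeDistStr_apply]
    calc _ ≤ K ^ n * (SchwartzMap.seminorm ℂ 0 (4 * n) F + SchwartzMap.seminorm ℂ (6 * n) (4 * n) F +
          SchwartzMap.seminorm ℂ 0 0 F + SchwartzMap.seminorm ℂ (6 * n) 0 F +
          SchwartzMap.seminorm ℂ (10 * n) 0 F) :=
          Hstr k n hn q hq F hF (fun x l => a (βs k) • siteToE (x l)) (fun x l => by
            rw [sub_self, norm_zero]; exact mul_nonneg (by norm_num) (ha_pos k).le)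
      _ ≤ K ^ n * (5 * schwartzNorm (10 * n) F) := by
          gcongr; exact seminorm_budget_le_schwartzNorm n F
      _ = _ := by ring
  -- the joint index: arity and plane string (invalid strings carry the zero distribution)
  obtain ⟨T, hT⟩ : ∃ T : (i : Σ n : ℕ, (Fin n → Fin 4 × Fin 4)) → ℕ → (𝓢((Fin i.1 → E4), ℂ) →L[ℂ] ℂ),
      T = fun i k => if 2 ≤ i.1 ∧ (∀ l, (i.2 l).1 < (i.2 l).2) then
        latticeDistStr r.ρ (βs k) (Ls k) (a (βs k)) (fun l U => plaquetteObs r.ρ 0 (i.2 l).1 (i.2 l).2 U)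
          (fun l => wilsonTorusMean r.ρ (βs k) (Ls k) (fun U => plaquetteObs r.ρ 0 (i.2 l).1 (i.2 l).2 U))
        else 0 := ⟨_, rfl⟩
  let Mod : (i : Σ n : ℕ, (Fin n → Fin 4 × Fin 4)) → Submodule ℂ 𝓢((Fin i.1 → E4), ℂ) := fun i =>
    { carrier := {F | IsOffDiagonal F}
      add_mem' := fun hF hG => hF.add hG
      zero_mem' := isOffDiagonal_zero
      smul_mem' := fun c _ hF => hF.smul c }
  have hMod : ∀ i (F : 𝓢((Fin i.1 → E4), ℂ)), F ∈ Mod i ↔ IsOffDiagonal F := fun i F => Iff.rfl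
  have hbound : ∀ i k, ∀ F ∈ Mod i, ‖T i k F‖ ≤ 5 * K ^ i.1 * schwartzNorm (10 * i.1) F := by
    rintro ⟨n, q⟩ k F hF
    rw [hMod] at hF
    by_cases hn : 2 ≤ n ∧ (∀ l, (q l).1 < (q l).2)
    · rw [hT]; dsimp only; rw [if_pos hn]; exact hlatStr k n hn.1 q hn.2 F hF
    · rw [hT]; dsimp only; rw [if_neg hn]; simp only [zero_apply, norm_zero]
      exact mul_nonneg (by positivity) (schwartzNorm_nonneg _ _)
  obtain ⟨φ, hφ, Slim, hSlim, hconvS⟩ := exists_subseq_clm_limit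
    (X := fun i : (Σ n : ℕ, (Fin n → Fin 4 × Fin 4)) => Fin i.1 → E4) T Mod
    (fun i => 10 * i.1) (fun i => 5 * K ^ i.1) (fun i => by positivity) hbound
  -- the limits of the valid plane strings
  obtain ⟨Tq, hTq⟩ : ∃ Tq : (n : ℕ) → (Fin n → Fin 4 × Fin 4) → (𝓢((Fin n → E4), ℂ) →L[ℂ] ℂ),
      Tq = fun n q => Slim ⟨n, q⟩ := ⟨_, rfl⟩
  have hconvStr : ∀ n, 2 ≤ n → ∀ q : Fin n → Fin 4 × Fin 4, (∀ i, (q i).1 < (q i).2) →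
      ∀ F : 𝓢((Fin n → E4), ℂ), IsOffDiagonal F →
        Tendsto (fun j => latticeDistStr r.ρ (βs (φ j)) (Ls (φ j)) (a (βs (φ j)))
          (fun i U => plaquetteObs r.ρ 0 (q i).1 (q i).2 U)
          (fun i => wilsonTorusMean r.ρ (βs (φ j)) (Ls (φ j)) (fun U => plaquetteObs r.ρ 0 (q i).1 (q i).2 U)) F)
          atTop (𝓝 (Tq n q F)) := by
    intro n hn q hq F hF
    have h := hconvS ⟨n, q⟩ F ((hMod ⟨n, q⟩ F).2 hF)
    rw [hT] at h; dsimp only at h; simp only [if_pos (And.intro hn hq)] at h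
    rw [hTq]; exact h
  have hTqbd : ∀ (n : ℕ) (q : Fin n → Fin 4 × Fin 4) (F : 𝓢((Fin n → E4), ℂ)),
      ‖Tq n q F‖ ≤ 5 * K ^ n * schwartzNorm (10 * n) F := fun n q F => by
    rw [hTq]; exact hSlim ⟨n, q⟩ F
  -- the one-field limit: the sum over the valid strings
  obtain ⟨S, hSdef⟩ : ∃ S : (n : ℕ) → (𝓢((Fin n → E4), ℂ) →L[ℂ] ℂ), S = fun n =>
      ∑ q ∈ Fintype.piFinset (fun _ : Fin n => Finset.univ.filter fun p : Fin 4 × Fin 4 => p.1 < p.2), Tq n q :=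
    ⟨_, rfl⟩
  have hS_apply : ∀ n (F : 𝓢((Fin n → E4), ℂ)), S n F =
      ∑ q ∈ Fintype.piFinset (fun _ : Fin n => Finset.univ.filter fun p : Fin 4 × Fin 4 => p.1 < p.2), Tq n q F := by
    intro n F; rw [hSdef]; simp only [FunLike.coe_sum, Finset.sum_apply]
  have hconv2 : ∀ n, 2 ≤ n → ∀ F : 𝓢((Fin n → E4), ℂ), IsOffDiagonal F →
      Tendsto (fun j => latticeDist r.ρ (βs (φ j)) (Ls (φ j)) (a (βs (φ j))) r.curvature.F
        (wilsonTorusMean r.ρ (βs (φ j)) (Ls (φ j)) r.curvature.F) n F) atTop (𝓝 (S n F)) := by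
    intro n hn F hF
    rw [hS_apply]
    simp_rw [latticeDist_dens_eq_sum_latticeDistStr]
    refine tendsto_finsetSum _ fun q hq => hconvStr n hn q ((mem_planeStrings_iff q).1 hq) F hF
  have hcardP : ∀ n, ((Fintype.piFinset (fun _ : Fin n => Finset.univ.filter fun p : Fin 4 × Fin 4 => p.1 < p.2)).card : ℝ)
      = 6 ^ n := fun n => by
    rw [Fintype.card_piFinset, Finset.prod_const, Finset.card_univ, Fintype.card_fin, card_planes]; push_cast; ring
  have hS : ∀ n (F : 𝓢((Fin n → E4), ℂ)), ‖S n F‖ ≤ 5 * (6 * K) ^ n * schwartzNorm (10 * n) F := by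
    intro n F
    rw [hS_apply]
    calc _ ≤ ∑ q ∈ Fintype.piFinset (fun _ : Fin n => Finset.univ.filter fun p : Fin 4 × Fin 4 => p.1 < p.2),
          ‖Tq n q F‖ := norm_sum_le _ _
      _ ≤ ∑ _q ∈ Fintype.piFinset (fun _ : Fin n => Finset.univ.filter fun p : Fin 4 × Fin 4 => p.1 < p.2),
          5 * K ^ n * schwartzNorm (10 * n) F := Finset.sum_le_sum fun q _ => hTqbd n q F
      _ = 6 ^ n * (5 * K ^ n * schwartzNorm (10 * n) F) := by rw [Finset.sum_const, nsmul_eq_mul, hcardP]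
      _ = 5 * (6 * K) ^ n * schwartzNorm (10 * n) F := by rw [mul_pow]; ring
  /- 4. THE ONE-FIELD FAMILY: evaluation / zero / the limit -/
  obtain ⟨S₁, hS₁⟩ : ∃ S₁ : SchwingerFamily E4, S₁ = fun n =>
      if n = 0 then LabelledSchwingerFamily.evalAt (default : Fin n → E4) else if n = 1 then 0 else S n :=
    ⟨_, rfl⟩
  have hS₁0 : ∀ F : 𝓢((Fin 0 → E4), ℂ), S₁ 0 F = F default := fun F => by rw [hS₁]; simp
  have hS₁1 : ∀ F : 𝓢((Fin 1 → E4), ℂ), S₁ 1 F = 0 := fun F => by rw [hS₁]; simp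
  have hS₁2 : ∀ n, 2 ≤ n → S₁ n = S n := fun n hn => by
    rw [hS₁]; dsimp only; rw [if_neg (by omega), if_neg (by omega)]
  /- 5. THE SCHEME along the subsequence -/
  let sch : SpeciesScheme (YMSpecies G) :=
    { a := fun j => a (βs (φ j))
      a_pos := fun j => ha_pos _
      tendsto_a := ha_top.comp hφ.tendsto_atTop
      β := fun j => βs (φ j)
      L := fun j => Ls (φ j)
      tendsto_L := haL_top.comp hφ.tendsto_atTop
      c := fun _ j => ((a (βs (φ j)))⁻¹) ^ 4
      m := fun s j => wilsonTorusMean r.ρ (βs (φ j)) (Ls (φ j)) s.F }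
  /- 6. CONVERGENCE of every arity along `sch` -/
  have hconv_all : ∀ (n : ℕ) (F : 𝓢((Fin n → E4), ℂ)), IsOffDiagonal F →
      Tendsto (fun j => latticeDist r.ρ (βs (φ j)) (Ls (φ j)) (a (βs (φ j))) r.curvature.F
        (wilsonTorusMean r.ρ (βs (φ j)) (Ls (φ j)) r.curvature.F) n F) atTop (𝓝 (S₁ n F)) := by
    intro n F hF
    rcases Nat.lt_or_ge n 2 with hn | hn
    · interval_cases n
      · simp_rw [latticeDist_zero_apply r.ρ r.continuous, hS₁0]; exact tendsto_const_nhds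
      · simp_rw [latticeDist_one_apply, hS₁1]; exact tendsto_const_nhds
    · rw [hS₁2 n hn]; exact hconv2 n hn F hF
  /- 7. E0, E3, E1-translations by inheritance (toolkit VIII-b) -/
  obtain ⟨C₀, hC₀⟩ := r.curvature.bounded
  have hC₀0 : 0 ≤ C₀ := le_trans (abs_nonneg _) (hC₀ (fun _ => 1))
  have hW : ∀ (n j : ℕ) (x : Fin n → Site 4), |torusMoment r.ρ (βs (φ j)) (Ls (φ j)) r.curvature.F
      (wilsonTorusMean r.ρ (βs (φ j)) (Ls (φ j)) r.curvature.F) x| ≤ (C₀ + C₀) ^ n := by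
    intro n j x
    refine (abs_torusMoment_le_pow r _ _ r.curvature hC₀ _ x).trans ?_
    exact pow_le_pow_left₀ (by positivity)
      (by linarith [abs_wilsonTorusMean_le r (βs (φ j)) (Ls (φ j)) r.curvature hC₀]) n
  have hlatAll : ∀ n, ∀ᶠ j in atTop, ∀ F : 𝓢((Fin n → E4), ℂ), IsOffDiagonal F →
      ‖latticeDist r.ρ (βs (φ j)) (Ls (φ j)) (a (βs (φ j))) r.curvature.F
        (wilsonTorusMean r.ρ (βs (φ j)) (Ls (φ j)) r.curvature.F) n F‖ ≤ 5 * (6 * K) ^ n * schwartzNorm (10 * n) F := by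
    intro n
    refine Eventually.of_forall fun j F hF => ?_
    rcases Nat.lt_or_ge n 2 with hn | hn
    · interval_cases n
      · rw [latticeDist_zero_apply r.ρ r.continuous]
        have h1 := norm_le_schwartzNorm 0 F default
        have h0 := schwartzNorm_nonneg 0 F
        simp only [pow_zero, mul_one, mul_zero]
        linarith
      · rw [latticeDist_one_apply, norm_zero]; exact mul_nonneg (by positivity) (schwartzNorm_nonneg _ _)
    · rw [latticeDist_dens_eq_sum_latticeDistStr]
      calc _ ≤ ∑ q ∈ Fintype.piFinset (fun _ : Fin n => Finset.univ.filter fun p : Fin 4 × Fin 4 => p.1 < p.2),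
            ‖latticeDistStr r.ρ (βs (φ j)) (Ls (φ j)) (a (βs (φ j))) (fun i U => plaquetteObs r.ρ 0 (q i).1 (q i).2 U)
              (fun i => wilsonTorusMean r.ρ (βs (φ j)) (Ls (φ j)) (fun U => plaquetteObs r.ρ 0 (q i).1 (q i).2 U)) F‖ :=
            norm_sum_le _ _
        _ ≤ ∑ _q ∈ Fintype.piFinset (fun _ : Fin n => Finset.univ.filter fun p : Fin 4 × Fin 4 => p.1 < p.2),
            5 * K ^ n * schwartzNorm (10 * n) F :=
            Finset.sum_le_sum fun q hq => hlatStr (φ j) n hn q ((mem_planeStrings_iff q).1 hq) F hF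
        _ = 6 ^ n * (5 * K ^ n * schwartzNorm (10 * n) F) := by rw [Finset.sum_const, nsmul_eq_mul, hcardP]
        _ = 5 * (6 * K) ^ n * schwartzNorm (10 * n) F := by rw [mul_pow]; ring
  obtain ⟨hE0, hE3, htrans⟩ := limit_isNormalized_isSymmetric_translate r.ρ r.continuous
    (fun j => βs (φ j)) (fun j => Ls (φ j)) (fun j => a (βs (φ j))) r.curvature.F
    (fun j => wilsonTorusMean r.ρ (βs (φ j)) (Ls (φ j)) r.curvature.F) S₁ hconv_all
    (fun n => 5 * (6 * K) ^ n) (fun n => 10 * n) hlatAll (by positivity : (0 : ℝ) ≤ C₀ + C₀) hW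
    (fun j => ha_pos _) (fun j => ha_1 _) (fun j => hLa _) (ha_top.comp hφ.tendsto_atTop)
  /- 8. E0′ -/
  have hbdS₁ : ∀ (n : ℕ) (F : 𝓢((Fin n → E4), ℂ)), ‖S₁ n F‖ ≤ 5 * (6 * K) ^ n * schwartzNorm (10 * n) F := by
    intro n F
    rcases Nat.lt_or_ge n 2 with hn | hn
    · interval_cases n
      · rw [hS₁0]
        have h1 := norm_le_schwartzNorm 0 F default
        have h0 := schwartzNorm_nonneg 0 F
        simp only [pow_zero, mul_one, mul_zero]
        linarith
      · rw [hS₁1, norm_zero]; exact mul_nonneg (by positivity) (schwartzNorm_nonneg _ _)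
    · rw [hS₁2 n hn]; exact hS n F
  have hE0' : S₁.toLabelled.HasLinearGrowth := by
    intro _
    have h6K : 0 ≤ 6 * K := by positivity
    refine ⟨10, 5 * Real.exp (6 * K), 1, fun n k _ F _ => ?_⟩
    simp only [SchwingerFamily.toLabelled_apply, Real.rpow_one]
    calc ‖S₁ n F‖ ≤ 5 * (6 * K) ^ n * schwartzNorm (10 * n) F := hbdS₁ n F
      _ ≤ 5 * (Real.exp (6 * K) * (n.factorial : ℝ)) * schwartzNorm (10 * n) F := by
          gcongr
          · exact schwartzNorm_nonneg _ _
          · exact pow_le_exp_mul_factorial h6K n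
      _ = 5 * Real.exp (6 * K) * (n.factorial : ℝ) * schwartzNorm (n * 10) F := by rw [mul_comm n 10]; ring
  /- 9. THE ONE-FIELD CONVERGENCE CLAUSE along `sch` (`c a⁴ = 1`) -/
  have hYM : ∀ n : ℕ, n ≠ 0 → ∀ (f : Fin n → 𝓢(E4, ℝ)) (F : 𝓢((Fin n → E4), ℂ)),
      IsTensorOf F (fun i => ofRealTest (f i)) → IsOffDiagonal F →
        Tendsto (fun k : ℕ => ((latticeSchwinger r.ρ sch (fun s => s.F) k n (fun _ => r.curvature) f : ℝ) : ℂ))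
          atTop (𝓝 (S₁ n F)) := by
    intro n _ f F hF hod
    have hkey : ∀ k, ((latticeSchwinger r.ρ sch (fun s => s.F) k n (fun _ => r.curvature) f : ℝ) : ℂ) =
        latticeDist r.ρ (βs (φ k)) (Ls (φ k)) (a (βs (φ k))) r.curvature.F
          (wilsonTorusMean r.ρ (βs (φ k)) (Ls (φ k)) r.curvature.F) n F := by
      intro k
      rw [latticeSchwinger_eq_latticeDist r sch r.curvature k n f F hF]
      have hc : sch.c r.curvature k * (sch.a k) ^ 4 = 1 := by
        show ((a (βs (φ k)))⁻¹) ^ 4 * (a (βs (φ k))) ^ 4 = 1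
        rw [← mul_pow, inv_mul_cancel₀ (ha_pos _).ne', one_pow]
      rw [hc, one_pow, Complex.ofReal_one, one_mul]
    simp_rw [hkey]
    exact hconv_all n F hod
  /- 10. NON-TRIVIALITY, NON-GAUSSIANITY (toolkit XI-b) -/
  have hβφ : Tendsto (fun j => βs (φ j)) atTop atTop := hβs_top.comp hφ.tendsto_atTop
  have haLφ : Tendsto (fun j => a (βs (φ j)) * Ls (φ j)) atTop atTop := haL_top.comp hφ.tendsto_atTop
  have hNT := twoPointNontrivial_of_lowerBounds r ⟨v, ε₂, β₅, Λ₅, hv, hε₂, HQ2⟩ (fun j => βs (φ j))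
    (fun j => Ls (φ j)) hβφ haLφ S₁ hS₁1 (hconv_all 2)
  have hNG := nonGaussian_of_lowerBounds r ⟨f₃, g₃, h₃, ε₃, β₆, Λ₆, hfg, hgh, hfh, hε₃, HQ3⟩
    (fun j => βs (φ j)) (fun j => Ls (φ j)) hβφ haLφ S₁ hS₁1 (hconv_all 3)
  /- 11. THE LATTICE GAP in units `a` along `sch` -/
  have hLG : HasLatticeMassGap r sch c₁ :=
    hasLatticeMassGap_of_gapInUnits r Hgap sch (fun k => rfl) (Eventually.of_forall fun k => hβs2 _)
      (Eventually.of_forall fun k => hLS _)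
  /- 12. THE TWO SCHEME DEMANDS along `sch`: `b₀ ≤ β_{φ k}` and `g (β_{φ k}) k ≤ max_{i ≤ φ k} g (β_{φ k}) i ≤ L_{φ k}`
    (`k ≤ φ k` since `φ` is strictly monotone) -/
  have hdem : ∀ k, b₀ ≤ βs (φ k) ∧ g (βs (φ k)) k ≤ Ls (φ k) := fun k =>
    ⟨hβsb (φ k),
      (Finset.le_sup (f := g (βs (φ k))) (Finset.mem_range.2 (Nat.lt_succ_of_le hφ.le_apply))).trans (hLg (φ k))⟩
  /- 13. ASSEMBLE -/
  refine ⟨sch, S₁, Tq, K, ⟨fun k => rfl, fun s k => rfl, fun s k => rfl, hβφ, hE0, hE0', hE3, htrans, hS₁0, hS₁1,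
    fun n _ F hF => hconv_all n F hF, ⟨hK, hbdS₁⟩, hYM, hNT, hNG, ⟨c₁, hc₁, hLG⟩,
    fun k => ⟨hβs0 _, ha_24 _, hL14 _, hLa _⟩, fun k n hn q hq F hF y hy => Hstr (φ k) n hn q hq F hF y hy,
    fun k n hn q hq F hF c hc => Hdef (φ k) n hn q hq F hF c hc,
    fun n hn q hq F hF => hconvStr n hn q hq F hF, fun n hn F => ?_⟩, fun k => hdem k⟩
  rw [hS₁2 n hn, hS_apply]

end Summit.QuantumFields.YangMills.Theorems.OSLegsFromFemtoAndGap

namespace Summit.QuantumFields.YangMills.Cruxes.OSLegsFromFemtoAndGap.DlrCollarTransfer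

/-- Registered stub `stub_growth`: for every compact `G`, lattice representation `r` and unit map `a > 0` with
`a → 0`, `MomentBounds6 ∧ LowerBounds ∧ GapInUnits` give, for every coupling threshold `b₀` and every growth
demand `g`, a soft bundle `SoftBundle G r a sch S₁ Tq K b₀ g` (the joint soft legs of toolkit XV along a scheme
with `b₀ ≤ β_k` and `g (β_k) k ≤ L_k`). -/
theorem stub_growth : Statement.stub_growth := by
  intro G _ _ _ _ _ _ r a hapos hlim hMB hLB hgap b₀ g
  exact Summit.QuantumFields.YangMills.Theorems.OSLegsFromFemtoAndGap.softLegs_joint_growth r hapos hlim hMB hLB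
    hgap b₀ g

end Summit.QuantumFields.YangMills.Cruxes.OSLegsFromFemtoAndGap.DlrCollarTransfer

end
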